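import Summits.Ventures.CertifiedManyBodySolver.Downfold.EmeryAntibondingBandBorel
import Summits.Ventures.CertifiedManyBodySolver.Downfold.EmeryFermiScalePoint
import HarnessLib

/-!
# THE FILLING MAP IS CONTINUOUS AND EVERY CERTIFIED DOPING WINDOW HAS A FERMI ENERGY: level sets of the σ antibonding band
# are Lebesgue-null (sections are single points), `abFilling` is continuous, and the census hypotheses are inhabited

Venture CertifiedManyBodySolver, cell `pub/hubbard-downfold` (stage S1; INFLATION-RULES-3to1-B §B.82 (c)–(e)), seat
hubbard-downfold-mod-4 (technique B, g34); namespace `Summit.Ventures.CertifiedManyBodySolver.Downfold.Emery`. Everything PROVED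
(0 sorry). WHAT THIS IS NOT: a statement about any material; `U = 0` one-body kinematics of the σ (d–p_x–p_y + t_pp, t_pp′) model.

Every census theorem of this series (`EmeryFermiScalePoints…`, `EmeryFermiDWeight…`, `EmeryZonePartition…`, `EmeryVsqProfileRows…`,
…) is quantified «for every Fermi energy `ε` with `abFilling(ε) = ν`»; that such an `ε` EXISTS was never proved — `abFilling` is
monotone (`abFilling_mono`) but a jump (a level set `{ε_AB = ε}` of positive measure, i.e. a flat piece of band) would make the
statements vacuous at the skipped fillings. This file removes the gap:

* §1 SECTIONS ARE POINTS. At fixed energy the secular cubic is AFFINE in `y = sin²(k_y/2)` at fixed `x = sin²(k_x/2)`: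
  `charCubic = (cA − 4fsD·x) − y·(4fsD + 16fsN·x)` (`charCubic_section`). In the regime `fsD(ε) ≥ 0`, `fsN(ε) > 0` the
  coefficient is positive for `x > 0`, so on every line `k_x = const ≠ 0` of the quadrant the zero set of `charCubic(·, ε)` — which
  contains the level set `{ε_AB = ε}` — has AT MOST ONE POINT (`zeroSet_section_subsingleton`; `halfSq` is injective on `[0, π]`).
* §2 LEVEL SETS ARE NULL. By Tonelli on the (Borel, `EmeryAntibondingBandBorel`) zero set, `volume(Q ∩ {ε_AB = ε}) = 0`
  (`volume_levelSet_eq_zero`) — the σ antibonding band has no flat piece at any regime energy; hence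
  `volume(Q ∩ {ε_AB ≤ ε}) = volume(Q ∩ {ε_AB < ε})` and `abFilling(0) = 0` (`abFilling_zero`: the band bottom `ε_AB(Γ) = 0` is
  the only zero).
* §3 THE FILLING MAP IS CONTINUOUS at every regime energy (`continuousAt_abFilling`: measure continuity from above on the
  sub-level sets and from below on the strict ones) and on every interval `[e₁, e₂] ⊂ [0, t_pd²/t_pp′]` for `t_pd, t_pp > 0`,
  `0 ≤ t_pp′ ≤ t_pp`, `Δ ≥ 0` (`continuousOn_abFilling_Icc`).
* §4 THE FERMI ENERGY EXISTS: by the intermediate value theorem every filling between `abFilling(e₁)` and `abFilling(e₂)` is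
  attained in `[e₁, e₂]` (`exists_fermiEnergy`); in particular a passing `pointBracketCheck` (the census Fermi-energy bracket of
  `EmeryFermiScalePoint`) makes EVERY filling `ν ∈ [ν₁, ν₂]` attained inside the certified bracket
  (`exists_fermiEnergy_of_pointBracketCheck`) — the hypotheses «`abFilling(ε) ∈ [ν, ν]`» of the census rows are INHABITED, and
  their conclusions hold AT the (existing) Fermi energy of the row (`census_reading_inhabited`).

Sources: three-band model [HybertsenSchluterChristensen1989, Eq. (1)]; bilinear contour form [AndersenEtAl1995, §6]; Tonelli,
continuity of measures along monotone sequences, intermediate value theorem [folklore].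
-/

noncomputable section

namespace Summit.Ventures.CertifiedManyBodySolver.Downfold.Emery

open Real MeasureTheory Set Filter Topology
open scoped ENNReal

/-! ## §1 Sections of a level set are single points -/

/-- `k ↦ sin²(k/2)` is injective on `[0, π]` (the cosine is strictly antitone there). [folklore] -/
theorem halfSq_injOn : InjOn halfSq (Icc 0 π) := by
  intro k₁ h₁ k₂ h₂ h
  rw [halfSq_eq_cos, halfSq_eq_cos] at h
  have hc : Real.cos k₁ = Real.cos k₂ := by linarith
  exact Real.strictAntiOn_cos.injOn h₁ h₂ hc

/-- `sin²(k/2) > 0` for `k ∈ (0, π]`. [folklore] -/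
theorem halfSq_pos {k : ℝ} (h0 : 0 < k) (hπ : k ≤ π) : 0 < halfSq k := by
  unfold halfSq
  have : 0 < Real.sin (k / 2) := Real.sin_pos_of_pos_of_lt_pi (by linarith) (by linarith [pi_pos])
  positivity

/-- At fixed energy and fixed `x` the secular cubic is AFFINE in `y`:
`charCubic = (cA − 4fsD·x) − y·(4fsD + 16fsN·x)`. [cite: AndersenEtAl1995, §6 (bilinear contour form)] -/
theorem charCubic_section (Δ a b c x y ε : ℝ) :
    charCubic Δ a b c x y ε = (cA Δ ε - 4 * fsD Δ a c ε * x) - y * (4 * fsD Δ a c ε + 16 * fsN a b c ε * x) := by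
  rw [charCubic_bilinear]; ring

/-- The level set of the antibonding band lies in the zero set of the secular cubic at that energy. [folklore] -/
theorem levelSet_subset_zeroSet (Δ a b c ε : ℝ) :
    bzQuad ∩ {k | abEnergyK Δ a b c k = ε} ⊆ bzQuad ∩ {k : ℝ × ℝ | charCubic Δ a b c (halfSq k.1) (halfSq k.2) ε = 0} := by
  rintro k ⟨hk, hE⟩
  refine ⟨hk, ?_⟩
  simp only [mem_setOf_eq] at hE ⊢
  rw [← hE]
  exact charCubic_abBand Δ a b c (halfSq k.1) (halfSq k.2)

/-- The zero set of the secular cubic on the quadrant is Borel (closed). [folklore] -/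
theorem measurableSet_zeroSet (Δ a b c ε : ℝ) :
    MeasurableSet (bzQuad ∩ {k : ℝ × ℝ | charCubic Δ a b c (halfSq k.1) (halfSq k.2) ε = 0}) := by
  refine measurableSet_bzQuad.inter ?_
  have h1 : Continuous fun k : ℝ × ℝ => halfSq k.1 := continuous_halfSq.comp continuous_fst
  have h2 : Continuous fun k : ℝ × ℝ => halfSq k.2 := continuous_halfSq.comp continuous_snd
  have hc : Continuous fun k : ℝ × ℝ => charCubic Δ a b c (halfSq k.1) (halfSq k.2) ε := by
    unfold charCubic; fun_prop
  exact (isClosed_eq hc continuous_const).measurableSet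

/-- **SECTIONS ARE POINTS.** In the regime `fsD(ε) ≥ 0`, `fsN(ε) > 0`, on every line `k_x = k₁ ≠ 0` the zero set of the secular
cubic in the quadrant has at most one point. [folklore] -/
theorem zeroSet_section_subsingleton {Δ a b c ε : ℝ} (hD : 0 ≤ fsD Δ a c ε) (hN : 0 < fsN a b c ε) {k₁ : ℝ} (hk₁ : k₁ ≠ 0) :
    (Prod.mk k₁ ⁻¹' (bzQuad ∩ {k : ℝ × ℝ | charCubic Δ a b c (halfSq k.1) (halfSq k.2) ε = 0})).Subsingleton := by
  intro k₂ hk₂ k₂' hk₂'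
  simp only [mem_preimage, mem_inter_iff, bzQuad, mem_prod, mem_Icc, mem_setOf_eq] at hk₂ hk₂'
  obtain ⟨⟨⟨h1l, h1r⟩, ⟨h2l, h2r⟩⟩, hz⟩ := hk₂
  obtain ⟨⟨-, ⟨h2l', h2r'⟩⟩, hz'⟩ := hk₂'
  have hx : 0 < halfSq k₁ := halfSq_pos (lt_of_le_of_ne h1l (Ne.symm hk₁)) h1r
  have hβ : 0 < 4 * fsD Δ a c ε + 16 * fsN a b c ε * halfSq k₁ := by nlinarith
  rw [charCubic_section] at hz hz'
  have hy : halfSq k₂ = halfSq k₂' := by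
    have hm : (halfSq k₂ - halfSq k₂') * (4 * fsD Δ a c ε + 16 * fsN a b c ε * halfSq k₁) = 0 := by linarith
    rcases mul_eq_zero.mp hm with h | h
    · linarith
    · exact absurd h hβ.ne'
  exact halfSq_injOn ⟨h2l, h2r⟩ ⟨h2l', h2r'⟩ hy

/-! ## §2 Level sets are Lebesgue-null -/

/-- **THE ZERO SET OF THE SECULAR CUBIC IS NULL** (regime `fsD(ε) ≥ 0`, `fsN(ε) > 0`): by Tonelli its measure is the integral
of the (zero) measures of its sections. [folklore] -/
theorem volume_zeroSet_eq_zero {Δ a b c ε : ℝ} (hD : 0 ≤ fsD Δ a c ε) (hN : 0 < fsN a b c ε) :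
    volume (bzQuad ∩ {k : ℝ × ℝ | charCubic Δ a b c (halfSq k.1) (halfSq k.2) ε = 0}) = 0 := by
  rw [Measure.volume_eq_prod, Measure.prod_apply (measurableSet_zeroSet Δ a b c ε)]
  have hae : ∀ᵐ k₁ : ℝ ∂volume,
      volume (Prod.mk k₁ ⁻¹' (bzQuad ∩ {k : ℝ × ℝ | charCubic Δ a b c (halfSq k.1) (halfSq k.2) ε = 0})) = 0 := by
    have hmem : ({0} : Set ℝ)ᶜ ∈ ae (volume : Measure ℝ) := compl_mem_ae_iff.mpr (measure_singleton 0)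
    filter_upwards [hmem] with k₁ hk₁
    exact (zeroSet_section_subsingleton hD hN hk₁).measure_zero volume
  rw [lintegral_congr_ae hae, lintegral_zero]

/-- **LEVEL SETS OF THE ANTIBONDING BAND ARE NULL**: `volume(Q ∩ {ε_AB = ε}) = 0` — no flat piece of band at a regime
energy. [folklore] -/
theorem volume_levelSet_eq_zero {Δ a b c ε : ℝ} (hD : 0 ≤ fsD Δ a c ε) (hN : 0 < fsN a b c ε) :
    volume (bzQuad ∩ {k | abEnergyK Δ a b c k = ε}) = 0 :=
  measure_mono_null (levelSet_subset_zeroSet Δ a b c ε) (volume_zeroSet_eq_zero hD hN)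

/-- Hence the closed and the open sub-level parts of the quadrant have the same measure. [folklore] -/
theorem volume_subLevel_eq_strict {Δ a b c ε : ℝ} (hD : 0 ≤ fsD Δ a c ε) (hN : 0 < fsN a b c ε) :
    volume (bzQuad ∩ {k | abEnergyK Δ a b c k ≤ ε}) = volume (bzQuad ∩ {k | abEnergyK Δ a b c k < ε}) := by
  apply le_antisymm
  · have hsub : bzQuad ∩ {k | abEnergyK Δ a b c k ≤ ε} ⊆
        (bzQuad ∩ {k | abEnergyK Δ a b c k < ε}) ∪ (bzQuad ∩ {k | abEnergyK Δ a b c k = ε}) := by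
      rintro k ⟨hk, hle⟩
      rcases (show abEnergyK Δ a b c k ≤ ε from hle).lt_or_eq with h | h
      · exact Or.inl ⟨hk, h⟩
      · exact Or.inr ⟨hk, h⟩
    calc volume (bzQuad ∩ {k | abEnergyK Δ a b c k ≤ ε})
        ≤ volume ((bzQuad ∩ {k | abEnergyK Δ a b c k < ε}) ∪ (bzQuad ∩ {k | abEnergyK Δ a b c k = ε})) :=
          measure_mono hsub
      _ ≤ volume (bzQuad ∩ {k | abEnergyK Δ a b c k < ε}) + volume (bzQuad ∩ {k | abEnergyK Δ a b c k = ε}) :=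
          measure_union_le _ _
      _ = volume (bzQuad ∩ {k | abEnergyK Δ a b c k < ε}) := by rw [volume_levelSet_eq_zero hD hN, add_zero]
  · exact measure_mono fun k ⟨hk, h⟩ => ⟨hk, le_of_lt (show abEnergyK Δ a b c k < ε from h)⟩

/-- The regime at the band bottom: `fsD(0) = Δt_pd² ≥ 0`, `fsN(0) = 2t_pd²(t_pp′ + t_pp) > 0`. [folklore] -/
theorem regime_zero {Δ a b c : ℝ} (hΔ : 0 ≤ Δ) (ha : 0 < a) (hc : 0 ≤ c) (hb : 0 < b) :
    0 ≤ fsD Δ a c 0 ∧ 0 < fsN a b c 0 := by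
  unfold fsD fsN
  constructor
  · nlinarith [sq_nonneg a]
  · have : 0 < a ^ 2 := by positivity
    nlinarith

/-- **`abFilling(0) = 0`**: the occupied set at the band bottom is the level set `{ε_AB = 0}` (`ε_AB ≥ 0` on the quadrant),
which is null. [folklore] -/
theorem abFilling_zero {Δ a b c : ℝ} (hΔ : 0 ≤ Δ) (ha : 0 < a) (hc : 0 ≤ c) (hb : 0 < b) : abFilling Δ a b c 0 = 0 := by
  obtain ⟨hD, hN⟩ := regime_zero hΔ ha hc hb
  have hsub : abOccSet Δ a b c 0 ⊆ bzQuad ∩ {k | abEnergyK Δ a b c k = 0} := by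
    rw [abOccSet_eq]
    rintro k ⟨hk, hle⟩
    refine ⟨hk, le_antisymm hle ?_⟩
    exact abBand_nonneg hΔ hc hb.le (halfSq_nonneg _) (halfSq_nonneg _)
  unfold abFilling
  rw [measure_mono_null hsub (volume_levelSet_eq_zero hD hN), ENNReal.toReal_zero, zero_div]

/-! ## §3 The filling map is continuous -/

/-- Right continuity of the occupied volume: `volume(Q ∩ {ε_AB ≤ ε + 1/(n+1)}) → volume(Q ∩ {ε_AB ≤ ε})`. [folklore] -/
theorem tendsto_volume_subLevel_right (Δ a b c ε : ℝ) :
    Tendsto (fun n : ℕ => volume (bzQuad ∩ {k | abEnergyK Δ a b c k ≤ ε + 1 / ((n : ℝ) + 1)})) atTop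
      (𝓝 (volume (bzQuad ∩ {k | abEnergyK Δ a b c k ≤ ε}))) := by
  set s : ℕ → Set (ℝ × ℝ) := fun n => bzQuad ∩ {k | abEnergyK Δ a b c k ≤ ε + 1 / ((n : ℝ) + 1)} with hs
  have hanti : Antitone s := by
    intro m n hmn k hk
    have hmn' : (m : ℝ) ≤ n := by exact_mod_cast hmn
    have hdiv : (1 : ℝ) / ((n : ℝ) + 1) ≤ 1 / ((m : ℝ) + 1) :=
      one_div_le_one_div_of_le (by positivity) (by linarith)
    exact ⟨hk.1, le_trans (show abEnergyK Δ a b c k ≤ ε + 1 / ((n : ℝ) + 1) from hk.2) (by linarith)⟩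
  have hinter : (⋂ n, s n) = bzQuad ∩ {k | abEnergyK Δ a b c k ≤ ε} := by
    ext k
    simp only [hs, mem_iInter, mem_inter_iff, mem_setOf_eq]
    constructor
    · intro h
      refine ⟨(h 0).1, ?_⟩
      by_contra hlt
      push Not at hlt
      obtain ⟨n, hn⟩ := exists_nat_one_div_lt (show 0 < abEnergyK Δ a b c k - ε by linarith)
      have := (h n).2
      linarith
    · intro h n
      have h0 : (0 : ℝ) < 1 / ((n : ℝ) + 1) := by positivity
      exact ⟨h.1, h.2.trans (by linarith)⟩
  have ht := tendsto_measure_iInter_atTop (μ := volume) (s := s)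
    (fun n => (measurableSet_bzQuad.inter (measurableSet_subLevel Δ a b c _)).nullMeasurableSet) hanti
    ⟨0, ne_top_of_le_ne_top volume_bzQuad_ne_top (measure_mono inter_subset_left)⟩
  rw [hinter] at ht
  exact ht

/-- Left continuity of the occupied volume: `volume(Q ∩ {ε_AB ≤ ε − 1/(n+1)}) → volume(Q ∩ {ε_AB < ε})`. [folklore] -/
theorem tendsto_volume_subLevel_left (Δ a b c ε : ℝ) :
    Tendsto (fun n : ℕ => volume (bzQuad ∩ {k | abEnergyK Δ a b c k ≤ ε - 1 / ((n : ℝ) + 1)})) atTop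
      (𝓝 (volume (bzQuad ∩ {k | abEnergyK Δ a b c k < ε}))) := by
  set s : ℕ → Set (ℝ × ℝ) := fun n => bzQuad ∩ {k | abEnergyK Δ a b c k ≤ ε - 1 / ((n : ℝ) + 1)} with hs
  have hmono : Monotone s := by
    intro m n hmn k hk
    have hmn' : (m : ℝ) ≤ n := by exact_mod_cast hmn
    have hdiv : (1 : ℝ) / ((n : ℝ) + 1) ≤ 1 / ((m : ℝ) + 1) :=
      one_div_le_one_div_of_le (by positivity) (by linarith)
    exact ⟨hk.1, le_trans (show abEnergyK Δ a b c k ≤ ε - 1 / ((m : ℝ) + 1) from hk.2) (by linarith)⟩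
  have hunion : (⋃ n, s n) = bzQuad ∩ {k | abEnergyK Δ a b c k < ε} := by
    ext k
    simp only [hs, mem_iUnion, mem_inter_iff, mem_setOf_eq]
    constructor
    · rintro ⟨n, hk, hle⟩
      have h0 : (0 : ℝ) < 1 / ((n : ℝ) + 1) := by positivity
      exact ⟨hk, lt_of_le_of_lt hle (by linarith)⟩
    · rintro ⟨hk, hlt⟩
      obtain ⟨n, hn⟩ := exists_nat_one_div_lt (show 0 < ε - abEnergyK Δ a b c k by linarith)
      exact ⟨n, hk, by linarith⟩
  have ht := tendsto_measure_iUnion_atTop (μ := volume) (s := s) hmono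
  rw [hunion] at ht
  exact ht

/-- **THE FILLING MAP IS CONTINUOUS AT EVERY REGIME ENERGY** (`fsD(ε) ≥ 0`, `fsN(ε) > 0`). [folklore] -/
theorem continuousAt_abFilling {Δ a b c ε : ℝ} (hD : 0 ≤ fsD Δ a c ε) (hN : 0 < fsN a b c ε) :
    ContinuousAt (abFilling Δ a b c) ε := by
  -- the occupied volume as a real function of the energy
  set V : ℝ → ℝ := fun e => (volume (bzQuad ∩ {k | abEnergyK Δ a b c k ≤ e})).toReal with hV
  have hVfin : ∀ e, volume (bzQuad ∩ {k | abEnergyK Δ a b c k ≤ e}) ≠ ⊤ := fun e =>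
    ne_top_of_le_ne_top volume_bzQuad_ne_top (measure_mono inter_subset_left)
  have hVmono : Monotone V := by
    intro e e' h
    exact ENNReal.toReal_mono (hVfin e') (measure_mono fun k ⟨hk, hle⟩ =>
      ⟨hk, le_trans (show abEnergyK Δ a b c k ≤ e from hle) h⟩)
  have hF : abFilling Δ a b c = fun e => V e / π ^ 2 := by
    funext e; unfold abFilling; rw [abOccSet_eq]
  -- the two one-sided limits of V at ε equal V ε
  have hR : Tendsto (fun n : ℕ => V (ε + 1 / ((n : ℝ) + 1))) atTop (𝓝 (V ε)) :=
    (ENNReal.tendsto_toReal (hVfin ε)).comp (tendsto_volume_subLevel_right Δ a b c ε)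
  have hL : Tendsto (fun n : ℕ => V (ε - 1 / ((n : ℝ) + 1))) atTop (𝓝 (V ε)) := by
    have h := tendsto_volume_subLevel_left Δ a b c ε
    rw [← volume_subLevel_eq_strict hD hN] at h
    exact (ENNReal.tendsto_toReal (hVfin ε)).comp h
  -- ε–δ from the monotone squeeze
  have hVcont : ContinuousAt V ε := by
    rw [Metric.continuousAt_iff]
    intro η hη
    obtain ⟨n₁, hn₁⟩ := Metric.tendsto_atTop.mp hR η hη
    obtain ⟨n₂, hn₂⟩ := Metric.tendsto_atTop.mp hL η hη
    have h₁ := hn₁ n₁ le_rfl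
    have h₂ := hn₂ n₂ le_rfl
    rw [Real.dist_eq] at h₁ h₂
    refine ⟨min (1 / ((n₁ : ℝ) + 1)) (1 / ((n₂ : ℝ) + 1)), by positivity, fun e he => ?_⟩
    rw [Real.dist_eq] at he ⊢
    have hlo : ε - 1 / ((n₂ : ℝ) + 1) ≤ e := by
      have := (abs_lt.mp he).1; have := min_le_right (1 / ((n₁ : ℝ) + 1)) (1 / ((n₂ : ℝ) + 1)); linarith
    have hhi : e ≤ ε + 1 / ((n₁ : ℝ) + 1) := by
      have := (abs_lt.mp he).2; have := min_le_left (1 / ((n₁ : ℝ) + 1)) (1 / ((n₂ : ℝ) + 1)); linarith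
    have m1 := hVmono hlo
    have m2 := hVmono hhi
    have a1 := (abs_lt.mp h₁).2
    have a2 := (abs_lt.mp h₂).1
    rw [abs_lt]; constructor <;> linarith
  rw [hF]
  exact hVcont.div_const _

/-- The regime holds on `[e₁, e₂] ⊂ [0, ∞)` when `Δ ≥ 0`, `t_pd > 0`, `0 ≤ t_pp′ ≤ t_pp`, `t_pp > 0` and `t_pp′·e₂ ≤ t_pd²`. [folklore] -/
theorem regime_of_mem_Icc {Δ a b c e₁ e₂ ε : ℝ} (hΔ : 0 ≤ Δ) (ha : 0 < a) (hb : 0 < b) (hc : 0 ≤ c) (hcb : c ≤ b)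
    (he₁ : 0 ≤ e₁) (hD₂ : c * e₂ ≤ a ^ 2) (hε : ε ∈ Icc e₁ e₂) : 0 ≤ fsD Δ a c ε ∧ 0 < fsN a b c ε := by
  obtain ⟨h1, h2⟩ := hε
  unfold fsD fsN
  have hε0 : 0 ≤ ε := he₁.trans h1
  constructor
  · have : c * ε ≤ a ^ 2 := (mul_le_mul_of_nonneg_left h2 hc).trans hD₂
    have : 0 ≤ Δ + ε := by linarith
    nlinarith
  · have : 0 < a ^ 2 := by positivity
    have : 0 ≤ b ^ 2 - c ^ 2 := by nlinarith
    nlinarith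

/-- **CONTINUITY ON A WINDOW**: `abFilling` is continuous on `[e₁, e₂]` under the regime hypotheses of `regime_of_mem_Icc`.
[folklore] -/
theorem continuousOn_abFilling_Icc {Δ a b c e₁ e₂ : ℝ} (hΔ : 0 ≤ Δ) (ha : 0 < a) (hb : 0 < b) (hc : 0 ≤ c) (hcb : c ≤ b)
    (he₁ : 0 ≤ e₁) (hD₂ : c * e₂ ≤ a ^ 2) : ContinuousOn (abFilling Δ a b c) (Icc e₁ e₂) := by
  intro ε hε
  obtain ⟨hD, hN⟩ := regime_of_mem_Icc hΔ ha hb hc hcb he₁ hD₂ hε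
  exact (continuousAt_abFilling hD hN).continuousWithinAt

/-! ## §4 The Fermi energy exists -/

/-- **INTERMEDIATE FILLINGS ARE ATTAINED**: every `ν ∈ [abFilling e₁, abFilling e₂]` is the filling of some `ε ∈ [e₁, e₂]`.
[folklore] -/
theorem exists_fermiEnergy {Δ a b c e₁ e₂ ν : ℝ} (he : e₁ ≤ e₂) (hcont : ContinuousOn (abFilling Δ a b c) (Icc e₁ e₂))
    (h₁ : abFilling Δ a b c e₁ ≤ ν) (h₂ : ν ≤ abFilling Δ a b c e₂) :
    ∃ ε ∈ Icc e₁ e₂, abFilling Δ a b c ε = ν := by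
  obtain ⟨ε, hε, hfε⟩ := intermediate_value_Icc he hcont ⟨h₁, h₂⟩
  exact ⟨ε, hε, hfε⟩

/-- **EVERY CERTIFIED DOPING WINDOW HAS A FERMI ENERGY.** A passing `pointBracketCheck` (the `K = 384` Fermi-energy bracket of a
printed one-body set) with `t_pd, t_pp > 0`, `t_pp′ ≤ t_pp`: every filling `ν ∈ [ν₁, ν₂]` is attained at some `ε ∈ [e₁, e₂]`.
[folklore] -/
theorem exists_fermiEnergy_of_pointBracketCheck {Δ a b c e₁ e₂ ν₁ ν₂ : ℚ} {jout jin : List ℕ}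
    (h : pointBracketCheck Δ a b c e₁ e₂ ν₁ ν₂ jout jin = true) (ha : 0 < a) (hb : 0 < b) (hcb : c ≤ b)
    {ν : ℝ} (hν : ν ∈ Icc (ν₁ : ℝ) ν₂) :
    ∃ ε : ℝ, ε ∈ Icc (e₁ : ℝ) e₂ ∧ abFilling Δ a b c ε = ν := by
  simp only [pointBracketCheck, Bool.and_eq_true, decide_eq_true_eq] at h
  obtain ⟨⟨⟨⟨⟨⟨⟨⟨⟨⟨⟨⟨⟨he₁, he⟩, hΔ⟩, -⟩, -⟩, hc⟩, hD₁⟩, hN₁⟩, hD₂⟩, hN₂⟩, hout⟩, hso⟩, hin⟩, hsi⟩ := h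
  have hK : 0 < 384 := by norm_num
  -- the two certified counts (as in `fermiEnergy_mem_Icc_of_pointBracketCheck`)
  have hOutR : abFilling (Δ : ℝ) a b c (e₁ : ℝ) ≤
      ((rowSum 384 (fun i => jout.getD i 0) : ℕ) : ℝ) / ((384 : ℕ) : ℝ) ^ 2 := by
    refine abFilling_le_rowSum_outer hK gridEncl384 hout ?_ ?_ ?_ hD₁ hN₁
    · rw [cast_cAQ]
    · rw [cast_fsDQ]
    · rw [cast_fsNQ]
  have hInR : ((rowSum 384 (fun i => jin.getD i 0) : ℕ) : ℝ) / ((384 : ℕ) : ℝ) ^ 2 ≤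
      abFilling (Δ : ℝ) a b c (e₂ : ℝ) := by
    refine rowSum_inner_le_abFilling hK gridEncl384 hin ?_ ?_ ?_ hD₂ hN₂ le_rfl hΔ (by exact_mod_cast hc) ?_ ?_
      (he₁.trans he)
    · rw [cast_cAQ]
    · rw [cast_fsDQ]
    · rw [cast_fsNQ]
    · push_cast; exact le_rfl
    · push_cast; exact le_rfl
  have hso' : ((rowSum 384 (fun i => jout.getD i 0) : ℕ) : ℝ) / ((384 : ℕ) : ℝ) ^ 2 < (ν₁ : ℝ) := by
    rw [div_lt_iff₀ (by positivity)]
    have := (Rat.cast_lt (K := ℝ)).2 hso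
    push_cast at this ⊢
    exact this
  have hsi' : (ν₂ : ℝ) < ((rowSum 384 (fun i => jin.getD i 0) : ℕ) : ℝ) / ((384 : ℕ) : ℝ) ^ 2 := by
    rw [lt_div_iff₀ (by positivity)]
    have := (Rat.cast_lt (K := ℝ)).2 hsi
    push_cast at this ⊢
    exact this
  -- the regime on the whole window: `c·e₂ ≤ a²` from `fsD(e₂) ≥ 0`
  have hce : c * e₂ ≤ a ^ 2 := by
    unfold fsDQ at hD₂
    rcases (show 0 ≤ Δ + e₂ by linarith).lt_or_eq with hpos | hzero
    · nlinarith [(mul_nonneg_iff_of_pos_left hpos).mp hD₂]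
    · have : e₂ = 0 := by linarith
      rw [this, mul_zero]; positivity
  have hcont : ContinuousOn (abFilling (Δ : ℝ) a b c) (Icc (e₁ : ℝ) e₂) :=
    continuousOn_abFilling_Icc (by exact_mod_cast hΔ) (by exact_mod_cast ha) (by exact_mod_cast hb) (by exact_mod_cast hc)
      (by exact_mod_cast hcb) (by exact_mod_cast he₁) (by exact_mod_cast hce)
  obtain ⟨ε, hε, hfε⟩ := exists_fermiEnergy (ν := ν) (by exact_mod_cast he) hcont (by linarith [hν.1]) (by linarith [hν.2])
  exact ⟨ε, hε, hfε⟩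

/-- **CENSUS READINGS ARE INHABITED.** Any census conclusion `P ε` proved «for every `ε` with `abFilling(ε) ∈ [ν, ν]`» under a
passing `pointBracketCheck` with `ν ∈ [ν₁, ν₂]` HOLDS AT SOME Fermi energy `ε ∈ [e₁, e₂]` of filling exactly `ν`. [folklore] -/
theorem census_reading_inhabited {Δ a b c e₁ e₂ ν₁ ν₂ : ℚ} {jout jin : List ℕ}
    (h : pointBracketCheck Δ a b c e₁ e₂ ν₁ ν₂ jout jin = true) (ha : 0 < a) (hb : 0 < b) (hcb : c ≤ b)
    {ν : ℝ} (hν : ν ∈ Icc (ν₁ : ℝ) ν₂) {P : ℝ → Prop}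
    (hP : ∀ ε : ℝ, abFilling Δ a b c ε ∈ Icc ν ν → P ε) :
    ∃ ε : ℝ, ε ∈ Icc (e₁ : ℝ) e₂ ∧ abFilling Δ a b c ε = ν ∧ P ε := by
  obtain ⟨ε, hε, hfε⟩ := exists_fermiEnergy_of_pointBracketCheck h ha hb hcb hν
  exact ⟨ε, hε, hfε, hP ε ⟨hfε.ge, hfε.le⟩⟩

end Summit.Ventures.CertifiedManyBodySolver.Downfold.Emery
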